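import Summits.AtomisticToContinuum.FouriersLaw.Theses.GriffithsLimitExchange
import Summits.AtomisticToContinuum.FouriersLaw.Theorems.PhononMeanFreePathIncoherentBoundedSumRule

/-!
# Birth skeleton for crux `GriffithsLimitExchange.VanishingSurvival` (stmt-AtomisticToContinuum-13200)

Route `route-AtomisticToContinuum-GriffithsLimitExchange` (sub-problem `FouriersLaw`), crux rank 4, signature
read back from `Theses/GriffithsLimitExchange.lean` (NOT restated): for `P = pinnedChain ω₂ lam β γ` (all `> 0`),
`T > 0`, kernels `K_N(u) = ∫ (p₀²−T)·P_u(p₀²−T) dμ_T`, `Kt_N(u) = ∫ (p₀²−T)·P_u(p²_{N−1}−T) dμ_T` and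
`S_N(t) = (γ/T²) ∫_{(t,∞)} (K_N + Kt_N)`:  `∀ ε > 0 ∃ A > 0, ∀ᶠ N, N · S_N(A·N²) ≤ ε`.

## The line: FORECAST CAUCHY–SCHWARZ (survival = ⟨boundary forecast, energy forecast⟩)

Write `f = p₀² − T` (centred under `μ_T`), `H` the Hamiltonian, `P_s` the constructed equilibrium kernels.

* EXIT IDENTITY (IN TREE, used by name — `IncoherentBounded.kinObs_hamiltonian_pairing_sub`,
  `IncoherentBounded.sumRule_kinCorr`, `IncoherentBounded.kinCorr_integrableOn`): for `N ≥ 1`, `t ≥ 0`,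
  `γ ∫_{(t,∞)} (K_N + Kt_N) = C_N(t) := ∫ f · (P_t H) dμ_T = Cov_T(p₀²(0), H_N(t))`, i.e. `T² S_N(t)` is the
  boundary-injected energy still inside the chain at time `t` (`tail_identity` below, proved).
* `stub_forecastCauchySchwarz` (fixed `N`, size M): `C_N(2s)² ≤ F_N(s) · G_N(s)` with
  `F_N(s) = ‖P_s f‖²_{L²(μ_T)}` (how much the initial condition still forecasts the boundary kinetic energy) and
  `G_N(s) = ‖P_s H − μ_T(H)‖²_{L²(μ_T)}` (forecast variance of the total energy). Mechanism: Chapman–Kolmogorov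
  `P_{2s} = P_s P_s` (`pinnedChain_transitionKernel_add`), KERNEL DETAILED BALANCE up to the momentum flip `Θ`
  (landed `SubdiffusiveBondHeat.pinnedChain_detailedBalance` — all measurable square-integrable observables, `N ≥ 1`;
  here `f∘Θ = f`), `μ_T(P_s f) = μ_T(f) = 0`, Cauchy–Schwarz,
  `Θ`-invariance of `μ_T`.
* `stub_boundaryForecastBound` (N-uniform, open): `∃ M, ∀ A ≥ 1, ∀ᶠ N, N³ · F_N(A N²) ≤ M T²` — the boundary site is
  thermalised by its own bath except for the imprint of the surviving temperature-profile modes, whose amplitude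
  at the contact is a GRADIENT/N: `F_N(AN²) ≈ (T²/N³) Σ_k (πk)² e^{−2Dπ²k²A}` (and `F_N(s)` is non-increasing in
  `s` by `L²`-contractivity, whence uniformity in `A ≥ 1`). Failure mode isolated here: boundary-localised slow
  structures (breathers pinned near the contact). Harmonic anchor: band-edge count gives `N³F_N(AN²) = O(A⁻³)`.
* `stub_energyForgetting` (N-uniform, open): `∀ ε ∃ A ≥ 1, ∀ᶠ N, G_N(A N²) ≤ ε N T²` — of the `O(N T²)` equilibrium
  variance of `H_N`, the initial data forecasts at most `ε N T²` after a diffusive time `A N²`: the slowest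
  (k = 1) energy mode relaxes on the diffusive scale, `G_N(AN²) ≈ N T² Σ_{k odd} (2/πk)² e^{−2Dπ²k²A}`. Failure mode
  isolated here: bulk sub-diffusion / asymptotic localisation (De Roeck–Huveneers). No spectral gap is claimed
  (none ≥ c/N exists, Becker–Menegaki); one observable, one time scale, an `ε`-slack.
* COMPOSITION `VanishingSurvival_of` (sorry-free): with `M` from stub 2 and `A ≥ 1` from stub 3 at `ε' = ε²/M`,
  eventually in `N`: `(N·C_N(2AN²))² ≤ N²·F_N(AN²)·G_N(AN²) ≤ N²·(MT²/N³)·(ε²N T²/M) = (εT²)²`, so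
  `N·S_N(2A·N²) = N·C_N(2AN²)/T² ≤ ε`; the horizon of the crux is `2A`. Power counting is tight: both sides are
  `N⁻²` (`F ~ N⁻³`, `G ~ N`), so the Cauchy–Schwarz split loses no power of `N`.

Disproof used: none exists for this crux (`Cruxes/VanishingSurvival/` had no workfiles; `ledger negatives` has no
statement on `VanishingSurvival`, `F_N` or `G_N`; nearest FouriersLaw negative, `not_OddCorrectorDecay` = bath locality at
FIXED horizon, does not bite statements at horizon `AN² → ∞`). Sorries: exactly the three `stub_*` below; the
skeleton theorem `VanishingSurvival_of` takes the stubs BY NAME (`Statement.stub_*`) and is sorry-free.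
-/

noncomputable section

open MeasureTheory Filter Topology Set
open scoped NNReal

namespace Summit.AtomisticToContinuum.FouriersLaw.Cruxes.VanishingSurvival.Birth

open Literature.MathematicalPhysics.KineticTheory.HeatConduction
open Literature.MathematicalPhysics.KineticTheory OscillatorChain
open Summit.AtomisticToContinuum.FouriersLaw.Theorems.IncoherentBounded

/-! ## The three registered stubs -/

/-- **Stub 1 — forecast Cauchy–Schwarz (fixed `N`, size M).** For `N ≥ 1`, `s ≥ 0`:
`(∫ (p₀²−T) · P_{2s}H dμ_T)² ≤ ‖P_s(p₀²−T)‖²_{L²(μ_T)} · ‖P_s H − μ_T(H)‖²_{L²(μ_T)}`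
(Chapman–Kolmogorov + kernel detailed balance up to the momentum flip + centring + Cauchy–Schwarz). -/
theorem stub_forecastCauchySchwarz :
    ∀ ω₂ lam β γ : ℝ, 0 < ω₂ → 0 < lam → 0 < β → 0 < γ → ∀ T : ℝ, 0 < T →
      (let P := pinnedChain ω₂ lam β γ
       let C : ℕ → ℝ → ℝ := fun N t => if h : 0 < N then
         ∫ z, ((z.2 ⟨0, h⟩) ^ 2 - T) * (∫ y, P.hamiltonian N y ∂(P.transitionKernel N T T t.toNNReal z))
           ∂(P.gibbsMeasure N T) else 0
       let F : ℕ → ℝ → ℝ := fun N s => if h : 0 < N then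
         ∫ z, (∫ y, ((y.2 ⟨0, h⟩) ^ 2 - T) ∂(P.transitionKernel N T T s.toNNReal z)) ^ 2
           ∂(P.gibbsMeasure N T) else 0
       let G : ℕ → ℝ → ℝ := fun N s =>
         ∫ z, (∫ y, P.hamiltonian N y ∂(P.transitionKernel N T T s.toNNReal z) -
             ∫ w, P.hamiltonian N w ∂(P.gibbsMeasure N T)) ^ 2 ∂(P.gibbsMeasure N T)
       ∀ (N : ℕ) (s : ℝ), 0 < N → 0 ≤ s → C N (2 * s) ^ 2 ≤ F N s * G N s) := by
  sorry

/-- **Stub 2 — boundary forecast bound (uniform in `N`, open).** There is `M` with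
`N³ · ‖P_{A N²}(p₀²−T)‖²_{L²(μ_T)} ≤ M T²` for every `A ≥ 1` and all large `N`: at diffusive times the initial
condition forecasts the contact's kinetic temperature only through the gradient at the wall of the surviving
temperature-profile modes (amplitude `O(N^{-3/2})`). -/
theorem stub_boundaryForecastBound :
    ∀ ω₂ lam β γ : ℝ, 0 < ω₂ → 0 < lam → 0 < β → 0 < γ → ∀ T : ℝ, 0 < T →
      (let P := pinnedChain ω₂ lam β γ
       let F : ℕ → ℝ → ℝ := fun N s => if h : 0 < N then
         ∫ z, (∫ y, ((y.2 ⟨0, h⟩) ^ 2 - T) ∂(P.transitionKernel N T T s.toNNReal z)) ^ 2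
           ∂(P.gibbsMeasure N T) else 0
       ∃ M : ℝ, 0 < M ∧ ∀ A : ℝ, 1 ≤ A →
         ∀ᶠ N : ℕ in atTop, (N : ℝ) ^ 3 * F N (A * (N : ℝ) ^ 2) ≤ M * T ^ 2) := by
  sorry

/-- **Stub 3 — energy forgetting at the diffusive scale (uniform in `N`, open).** For every `ε > 0` there is
`A ≥ 1` with `‖P_{A N²} H − μ_T(H)‖²_{L²(μ_T)} ≤ ε N T²` for all large `N`: the forecast of the total energy from
the initial data retains at most an `ε`-fraction of its `O(N T²)` equilibrium variance after a diffusive time. -/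
theorem stub_energyForgetting :
    ∀ ω₂ lam β γ : ℝ, 0 < ω₂ → 0 < lam → 0 < β → 0 < γ → ∀ T : ℝ, 0 < T →
      (let P := pinnedChain ω₂ lam β γ
       let G : ℕ → ℝ → ℝ := fun N s =>
         ∫ z, (∫ y, P.hamiltonian N y ∂(P.transitionKernel N T T s.toNNReal z) -
             ∫ w, P.hamiltonian N w ∂(P.gibbsMeasure N T)) ^ 2 ∂(P.gibbsMeasure N T)
       ∀ ε : ℝ, 0 < ε → ∃ A : ℝ, 1 ≤ A ∧
         ∀ᶠ N : ℕ in atTop, G N (A * (N : ℝ) ^ 2) ≤ ε * (N : ℝ) * T ^ 2) := by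
  sorry

/-! ## Proved glue -/

/-- Real-analysis form of the exit identity: if `γ (∫_{(0,∞)} K + ∫_{(0,∞)} Kt) = T²` and
`c(r) − T² = −γ ∫₀ʳ (K + Kt)` for `r ≥ 0`, then `γ ∫_{(t,∞)} (K + Kt) = c(t)` for `t ≥ 0`. -/
theorem tail_abstract {K Kt c : ℝ → ℝ} {γ T : ℝ}
    (hK : IntegrableOn K (Ioi 0)) (hKt : IntegrableOn Kt (Ioi 0))
    (hsum : γ * ((∫ u in Ioi (0 : ℝ), K u) + ∫ u in Ioi (0 : ℝ), Kt u) = T ^ 2)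
    (hpair : ∀ r : ℝ, 0 ≤ r → c r - T ^ 2 = -γ * ∫ s in (0 : ℝ)..r, (K s + Kt s))
    (t : ℝ) (ht : 0 ≤ t) :
    γ * ∫ u in Ioi t, (K u + Kt u) = c t := by
  have hKK : IntegrableOn (fun u => K u + Kt u) (Ioi 0) := hK.add hKt
  have hsplit : ∫ u in Ioi (0 : ℝ), (K u + Kt u) =
      (∫ u in Ioc (0 : ℝ) t, (K u + Kt u)) + ∫ u in Ioi t, (K u + Kt u) := by
    rw [← setIntegral_union (Ioc_disjoint_Ioi_same) measurableSet_Ioi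
      (hKK.mono_set Ioc_subset_Ioi_self) (hKK.mono_set (Ioi_subset_Ioi ht)), Ioc_union_Ioi_eq_Ioi ht]
  have hadd : ∫ u in Ioi (0 : ℝ), (K u + Kt u) = (∫ u in Ioi (0 : ℝ), K u) + ∫ u in Ioi (0 : ℝ), Kt u :=
    integral_add hK hKt
  have hIoc : ∫ u in Ioc (0 : ℝ) t, (K u + Kt u) = ∫ u in (0 : ℝ)..t, (K u + Kt u) :=
    (intervalIntegral.integral_of_le ht).symm
  have h1 : γ * (∫ u in Ioi t, (K u + Kt u)) =
      γ * (∫ u in Ioi (0 : ℝ), (K u + Kt u)) - γ * (∫ u in Ioc (0 : ℝ) t, (K u + Kt u)) := by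
    rw [hsplit]; ring
  rw [h1, hadd, hsum, hIoc]
  linarith [hpair t ht]

/-- **Exit identity, tail form (fixed `N`, from the tree).** For the equilibrium `N`-chain (`N ≥ 1`) and `t ≥ 0`:
`γ ∫_{(t,∞)} (K_N + Kt_N) = ∫ (p₀² − T) · (P_t H) dμ_T` — the kernel tail IS the covariance of the initial boundary
kinetic energy with the energy still in the chain at time `t`. [cite: KunduDharNarayan2009, arXiv:0809.4543 p. 3] -/
theorem tail_identity {ω₂ lam β γ : ℝ} (hω : 0 < ω₂) (hl : 0 ≤ lam) (hβ : 0 < β) (hγ : 0 < γ)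
    {N : ℕ} (hN : 0 < N) {T : ℝ} (hT : 0 < T) (t : ℝ) (ht : 0 ≤ t) :
    γ * ∫ u in Ioi t,
        ((∫ z, (z.2 ⟨0, hN⟩ ^ 2 - T) * (∫ y, (y.2 ⟨0, hN⟩ ^ 2 - T)
            ∂((pinnedChain ω₂ lam β γ).transitionKernel N T T u.toNNReal z)) ∂((pinnedChain ω₂ lam β γ).gibbsMeasure N T)) +
          ∫ z, (z.2 ⟨0, hN⟩ ^ 2 - T) * (∫ y, (y.2 ⟨N - 1, Nat.sub_lt hN one_pos⟩ ^ 2 - T)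
            ∂((pinnedChain ω₂ lam β γ).transitionKernel N T T u.toNNReal z)) ∂((pinnedChain ω₂ lam β γ).gibbsMeasure N T)) =
      ∫ z, (z.2 ⟨0, hN⟩ ^ 2 - T) * (∫ y, (pinnedChain ω₂ lam β γ).hamiltonian N y
        ∂((pinnedChain ω₂ lam β γ).transitionKernel N T T t.toNNReal z)) ∂((pinnedChain ω₂ lam β γ).gibbsMeasure N T) :=
  tail_abstract (kinCorr_integrableOn hω hl hβ hγ hN hT ⟨0, hN⟩ ⟨0, hN⟩)
    (kinCorr_integrableOn hω hl hβ hγ hN hT ⟨0, hN⟩ ⟨N - 1, Nat.sub_lt hN one_pos⟩)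
    (sumRule_kinCorr hω hl hβ hγ hN hT)
    (fun r hr => kinObs_hamiltonian_pairing_sub hω hl hβ hγ hN hT r hr) t ht

/-- **The composition in opaque-function form.** Tail identity + forecast Cauchy–Schwarz + boundary forecast
bound + energy forgetting ⇒ vanishing diffusive survival of the kernel tail. Pure real analysis (only `G ≥ 0` is
needed to multiply the two factor bounds; `F ≥ 0` is automatic but unused). -/
theorem vanishing_abstract {K Kt c F G : ℕ → ℝ → ℝ} {γ T : ℝ} (hT : 0 < T)
    (htail : ∀ (N : ℕ) (t : ℝ), 0 < N → 0 ≤ t → γ * ∫ u in Ioi t, (K N u + Kt N u) = c N t)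
    (hG0 : ∀ (N : ℕ) (s : ℝ), 0 ≤ G N s)
    (hdual : ∀ (N : ℕ) (s : ℝ), 0 < N → 0 ≤ s → c N (2 * s) ^ 2 ≤ F N s * G N s)
    (hM : ∃ M : ℝ, 0 < M ∧ ∀ A : ℝ, 1 ≤ A →
      ∀ᶠ N : ℕ in atTop, (N : ℝ) ^ 3 * F N (A * (N : ℝ) ^ 2) ≤ M * T ^ 2)
    (hforget : ∀ ε : ℝ, 0 < ε → ∃ A : ℝ, 1 ≤ A ∧
      ∀ᶠ N : ℕ in atTop, G N (A * (N : ℝ) ^ 2) ≤ ε * (N : ℝ) * T ^ 2) :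
    ∀ ε : ℝ, 0 < ε → ∃ A : ℝ, 0 < A ∧
      ∀ᶠ N : ℕ in atTop, (N : ℝ) * (γ / T ^ 2 * ∫ u in Ioi (A * (N : ℝ) ^ 2), (K N u + Kt N u)) ≤ ε := by
  intro ε hε
  obtain ⟨M, hM0, hM⟩ := hM
  obtain ⟨A, hA1, hG⟩ := hforget (ε ^ 2 / M) (by positivity)
  refine ⟨2 * A, by linarith, ?_⟩
  filter_upwards [hM A hA1, hG, eventually_gt_atTop 0] with N hFN hGN hNpos
  have hN : (0 : ℝ) < (N : ℝ) := Nat.cast_pos.mpr hNpos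
  have hs : (0 : ℝ) ≤ A * (N : ℝ) ^ 2 := by positivity
  have ht : (0 : ℝ) ≤ 2 * A * (N : ℝ) ^ 2 := by positivity
  -- the kernel tail is the energy covariance `c`
  rw [show γ / T ^ 2 * ∫ u in Ioi (2 * A * (N : ℝ) ^ 2), (K N u + Kt N u) =
      c N (2 * A * (N : ℝ) ^ 2) / T ^ 2 by
    rw [← htail N _ hNpos ht]; ring]
  -- Cauchy–Schwarz at `s = A N²`
  have hd := hdual N (A * (N : ℝ) ^ 2) hNpos hs
  rw [show (2 : ℝ) * (A * (N : ℝ) ^ 2) = 2 * A * (N : ℝ) ^ 2 by ring] at hd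
  -- the two factors
  have hF : F N (A * (N : ℝ) ^ 2) ≤ M * T ^ 2 / (N : ℝ) ^ 3 := by
    rw [le_div_iff₀ (by positivity)]; linarith [hFN]
  have hprod : F N (A * (N : ℝ) ^ 2) * G N (A * (N : ℝ) ^ 2) ≤
      (M * T ^ 2 / (N : ℝ) ^ 3) * (ε ^ 2 / M * (N : ℝ) * T ^ 2) :=
    mul_le_mul hF hGN (hG0 _ _) (by positivity)
  have hsq : ((N : ℝ) * c N (2 * A * (N : ℝ) ^ 2)) ^ 2 ≤ (ε * T ^ 2) ^ 2 := by
    calc ((N : ℝ) * c N (2 * A * (N : ℝ) ^ 2)) ^ 2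
        = (N : ℝ) ^ 2 * c N (2 * A * (N : ℝ) ^ 2) ^ 2 := by ring
      _ ≤ (N : ℝ) ^ 2 * (F N (A * (N : ℝ) ^ 2) * G N (A * (N : ℝ) ^ 2)) :=
          mul_le_mul_of_nonneg_left hd (by positivity)
      _ ≤ (N : ℝ) ^ 2 * ((M * T ^ 2 / (N : ℝ) ^ 3) * (ε ^ 2 / M * (N : ℝ) * T ^ 2)) :=
          mul_le_mul_of_nonneg_left hprod (by positivity)
      _ = (ε * T ^ 2) ^ 2 := by field_simp
  have hle : (N : ℝ) * c N (2 * A * (N : ℝ) ^ 2) ≤ ε * T ^ 2 := by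
    have habs := sq_le_sq.mp hsq
    rw [abs_of_pos (by positivity : (0 : ℝ) < ε * T ^ 2)] at habs
    exact le_trans (le_abs_self _) habs
  rw [mul_div_assoc', div_le_iff₀ (by positivity)]
  exact hle

/-! ## The composition: the three stubs imply the crux BY NAME -/

/-- The registered stub statements as NAMED propositions (so that the skeleton theorem's hypotheses are the declared
stubs by name, `#h21_check_skeleton` (ii)); each is literally the type of the corresponding `stub_*` theorem (fully
qualified: inside `def Statement.stub_x` the short name `stub_x` would denote the definiendum itself). -/
def Statement.stub_forecastCauchySchwarz : Prop :=
  type_of% _root_.Summit.AtomisticToContinuum.FouriersLaw.Cruxes.VanishingSurvival.Birth.stub_forecastCauchySchwarz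

@[inherit_doc Statement.stub_forecastCauchySchwarz]
def Statement.stub_boundaryForecastBound : Prop :=
  type_of% _root_.Summit.AtomisticToContinuum.FouriersLaw.Cruxes.VanishingSurvival.Birth.stub_boundaryForecastBound

@[inherit_doc Statement.stub_forecastCauchySchwarz]
def Statement.stub_energyForgetting : Prop :=
  type_of% _root_.Summit.AtomisticToContinuum.FouriersLaw.Cruxes.VanishingSurvival.Birth.stub_energyForgetting

/-- **`VanishingSurvival` from the three stubs** (sorry-free composition; hypotheses = the three declared stubs by
name; conclusion = the route's crux decl by name). With `M` from stub 2 and `A ≥ 1` from stub 3 at `ε' = ε²/M`,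
eventually in `N`: `(N·C_N(2AN²))² ≤ N²·(MT²/N³)·(ε²NT²/M) = (εT²)²`, and `N·S_N(2A·N²) = N·C_N(2AN²)/T² ≤ ε` by the
exit identity (`tail_identity`, tree). -/
theorem VanishingSurvival_of (h₁ : Statement.stub_forecastCauchySchwarz)
    (h₂ : Statement.stub_boundaryForecastBound) (h₃ : Statement.stub_energyForgetting) :
    Summit.AtomisticToContinuum.FouriersLaw.Theses.GriffithsLimitExchange.VanishingSurvival := by
  intro ω₂ lam β γ hω hl hβ hγ T hT
  have h1 := h₁ ω₂ lam β γ hω hl hβ hγ T hT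
  have h2 := h₂ ω₂ lam β γ hω hl hβ hγ T hT
  have h3 := h₃ ω₂ lam β γ hω hl hβ hγ T hT
  exact vanishing_abstract
    (K := fun N u => if h : 0 < N then
      ∫ z, ((z.2 ⟨0, h⟩) ^ 2 - T) * (∫ y, ((y.2 ⟨0, h⟩) ^ 2 - T)
        ∂((pinnedChain ω₂ lam β γ).transitionKernel N T T u.toNNReal z)) ∂((pinnedChain ω₂ lam β γ).gibbsMeasure N T)
      else 0)
    (Kt := fun N u => if h : 0 < N then
      ∫ z, ((z.2 ⟨0, h⟩) ^ 2 - T) * (∫ y, ((y.2 ⟨N - 1, by omega⟩) ^ 2 - T)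
        ∂((pinnedChain ω₂ lam β γ).transitionKernel N T T u.toNNReal z)) ∂((pinnedChain ω₂ lam β γ).gibbsMeasure N T)
      else 0)
    (c := fun N t => if h : 0 < N then
      ∫ z, ((z.2 ⟨0, h⟩) ^ 2 - T) * (∫ y, (pinnedChain ω₂ lam β γ).hamiltonian N y
        ∂((pinnedChain ω₂ lam β γ).transitionKernel N T T t.toNNReal z)) ∂((pinnedChain ω₂ lam β γ).gibbsMeasure N T)
      else 0)
    (F := fun N s => if h : 0 < N then
      ∫ z, (∫ y, ((y.2 ⟨0, h⟩) ^ 2 - T) ∂((pinnedChain ω₂ lam β γ).transitionKernel N T T s.toNNReal z)) ^ 2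
        ∂((pinnedChain ω₂ lam β γ).gibbsMeasure N T) else 0)
    (G := fun N s =>
      ∫ z, (∫ y, (pinnedChain ω₂ lam β γ).hamiltonian N y ∂((pinnedChain ω₂ lam β γ).transitionKernel N T T s.toNNReal z) -
          ∫ w, (pinnedChain ω₂ lam β γ).hamiltonian N w ∂((pinnedChain ω₂ lam β γ).gibbsMeasure N T)) ^ 2
        ∂((pinnedChain ω₂ lam β γ).gibbsMeasure N T))
    hT
    (fun N t hN ht => by simpa only [dif_pos hN] using tail_identity hω hl.le hβ hγ hN hT t ht)
    (fun N s => integral_nonneg fun _ => sq_nonneg _)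
    h1 h2 h3

/-- Consistency instance (an `example`, so that exactly ONE theorem of this file concludes the crux): the three sorried
stubs inhabit the three named statements, hence the crux modulo exactly those three `sorry`s. NOT a proof of the item. -/
example : Summit.AtomisticToContinuum.FouriersLaw.Theses.GriffithsLimitExchange.VanishingSurvival :=
  VanishingSurvival_of stub_forecastCauchySchwarz stub_boundaryForecastBound stub_energyForgetting

end Summit.AtomisticToContinuum.FouriersLaw.Cruxes.VanishingSurvival.Birth

end
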